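import Literature.NumberTheory.EllipticCurves.ExceptionalPrimesDensity
import Literature.NumberTheory.EllipticCurves.HeightDensityLemmas
import Mathlib.Data.Nat.Factorization.Basic
import Mathlib.Data.Nat.Cast.Order.Field
import HarnessLib

/-!
# Duke 1997 in the tree's normalisation: "no exceptional prime" has height density one

`ExceptionalPrimesDensity.lean` vendors Duke's Theorem 1 [Duke1997, Thm. 1] in Duke's own box
`𝒞(X) = {E_{r,s} : max(|r|³, s²) ≤ X⁶}`. The cell `pub-bsdpct` (PERCENT-FULL.md §(ii).2 (F1), §5) uses it
in the Bhargava–Shankar normalisation of the tree (`heightFamilyBelow Y = {max(4|A|³, 27B²) < Y}`,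
`HeightDensityGE`). This file PROVES the transfer (no new fact):

`heightDensityGE_noExceptionalPrime_of_duke :
  Duke1997_exceptionalPrimes_densityZero → HeightDensityGE (fun AB ↦ ∀ N, ¬ IsExceptionalPrime (E_AB) N) 1`.

Ingredients, all elementary and proved here:
* growth control of Duke's family: `X⁵/4 ≤ #𝒞(X) ≤ (2X² + 1)(2X³ + 1)` — the lower bound by injecting
  the COPRIME pairs `(r, s) ∈ [1, X²] × [1, X³]` (coprime ⇒ no prime `q` with `q⁴ ∣ r`, `q⁶ ∣ s`;
  `4r³ + 27s² > 0`), of which there are at least `X⁵/4` because the pairs with a common prime factor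
  `p` number `⌊X²/p⌋⌊X³/p⌋ ≤ X⁵/p²` and `∑_{n ≥ 2} 1/n² ≤ 3/4`; hence `#𝒞(2X + 2) ≤ 17028 · #𝒞(X)`
  for `X ≥ 1`;
* box nesting (`ExceptionalPrimesDensity.lean`): with `X₁` the least `X` with `Y ≤ X⁶` and
  `X₀ = ⌊(X₁ − 1)/2⌋` one has `𝒞(X₀) ⊆ {naiveHeight < Y} ⊆ 𝒞(X₁)` and `X₁ ≤ 2X₀ + 2`, so the proportion
  of curves of height `< Y` with an exceptional prime is `≤ 17028 · |ℰ(X₁)|/|𝒞(X₁)| → 0`.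

Brumer's asymptotic `|𝒞(X)| = (4/ζ(10))X⁵ + O(X³)` (Duke's (2)) is NOT needed: crude two-sided bounds
suffice for a density-ZERO transfer.
-/

namespace Literature.NumberTheory.EllipticCurves

open scoped Classical
open Filter Topology Finset

/-! ### Crude bounds for `#𝒞(X)` -/

/-- `𝒞` is monotone in `X`. [folklore] -/
theorem dukeFamily_mono {X X' : ℕ} (h : X ≤ X') : dukeFamily X ⊆ dukeFamily X' := by
  intro AB hAB
  rw [mem_dukeFamily_iff] at hAB ⊢
  refine ⟨hAB.1, le_trans hAB.2 ?_⟩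
  exact_mod_cast Nat.pow_le_pow_left h 6

/-- Upper bound: `#𝒞(X) ≤ (2X² + 1)(2X³ + 1)` (the enclosing box). [folklore] -/
theorem card_dukeFamily_le (X : ℕ) :
    (dukeFamily X).card ≤ (2 * X ^ 2 + 1) * (2 * X ^ 3 + 1) := by
  unfold dukeFamily
  refine le_trans (Finset.card_filter_le _ _) ?_
  rw [Finset.card_product, Int.card_Icc, Int.card_Icc]
  have h2 : ((X : ℤ) ^ 2 + 1 - -((X : ℤ) ^ 2)).toNat = 2 * X ^ 2 + 1 := by
    have : ((X : ℤ) ^ 2 + 1 - -((X : ℤ) ^ 2)) = ((2 * X ^ 2 + 1 : ℕ) : ℤ) := by push_cast; ring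
    rw [this, Int.toNat_natCast]
  have h3 : ((X : ℤ) ^ 3 + 1 - -((X : ℤ) ^ 3)).toNat = 2 * X ^ 3 + 1 := by
    have : ((X : ℤ) ^ 3 + 1 - -((X : ℤ) ^ 3)) = ((2 * X ^ 3 + 1 : ℕ) : ℤ) := by push_cast; ring
    rw [this, Int.toNat_natCast]
  rw [h2, h3]

/-- The positive coprime box `{(r, s) ∈ [1, A] × [1, B] : gcd(r, s) = 1}`. [folklore] -/
noncomputable def coprimeBox (A B : ℕ) : Finset (ℕ × ℕ) :=
  (Finset.Ioc 0 A ×ˢ Finset.Ioc 0 B).filter fun rs ↦ Nat.Coprime rs.1 rs.2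

/-- `∑_{n=2}^{N} 1/n² ≤ 3/4 − 1/N` for `N ≥ 2` (compare `1/n² ≤ 1/(n−1) − 1/n` from `n = 3` on).
[folklore] -/
theorem sum_Icc_inv_sq_le (N : ℕ) (hN : 2 ≤ N) :
    ∑ n ∈ Finset.Icc 2 N, (1 : ℝ) / (n : ℝ) ^ 2 ≤ 3 / 4 - 1 / N := by
  induction N, hN using Nat.le_induction with
  | base => norm_num
  | succ N hN ih =>
    rw [Finset.sum_Icc_succ_top (by omega), show ((N + 1 : ℕ) : ℝ) = (N : ℝ) + 1 by push_cast; ring]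
    have hN' : (2 : ℝ) ≤ N := by exact_mod_cast hN
    have hpos : (0 : ℝ) < N := by linarith
    have key : (1 : ℝ) / ((N : ℝ) + 1) ^ 2 ≤ 1 / N - 1 / (N + 1) := by
      rw [div_sub_div _ _ hpos.ne' (by linarith), le_div_iff₀ (by positivity),
        div_mul_eq_mul_div, div_le_iff₀ (by positivity)]
      nlinarith
    linarith

/-- `∑_{n=2}^{N} 1/n² ≤ 3/4` for every `N`. [folklore] -/
theorem sum_Icc_inv_sq_le' (N : ℕ) : ∑ n ∈ Finset.Icc 2 N, (1 : ℝ) / (n : ℝ) ^ 2 ≤ 3 / 4 := by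
  rcases lt_or_ge N 2 with hN | hN
  · rw [Finset.Icc_eq_empty_of_lt hN, Finset.sum_empty]; norm_num
  · have h := sum_Icc_inv_sq_le N hN
    have : (0 : ℝ) ≤ 1 / N := by positivity
    linarith

/-- Pairs in `[1, A] × [1, B]` with a common factor `n`: exactly `⌊A/n⌋ · ⌊B/n⌋`. [folklore] -/
theorem card_box_filter_dvd (A B n : ℕ) :
    ((Finset.Ioc 0 A ×ˢ Finset.Ioc 0 B).filter (fun rs : ℕ × ℕ ↦ n ∣ rs.1 ∧ n ∣ rs.2)).card
      = (A / n) * (B / n) := by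
  rw [Finset.filter_product, Finset.card_product, Nat.Ioc_filter_dvd_card_eq_div,
    Nat.Ioc_filter_dvd_card_eq_div]

/-- **At least a quarter of the box is coprime**: `A·B ≤ 4 · #coprimeBox A B`. The non-coprime pairs
lie in `⋃_{2 ≤ n ≤ A} {n ∣ r, n ∣ s}`, of total size `≤ ∑_{n ≥ 2} ⌊A/n⌋⌊B/n⌋ ≤ AB ∑_{n≥2} n⁻² ≤ ¾AB`.
[folklore] -/
theorem card_coprimeBox_ge (A B : ℕ) : (A : ℝ) * B ≤ 4 * (coprimeBox A B).card := by
  set box : Finset (ℕ × ℕ) := Finset.Ioc 0 A ×ˢ Finset.Ioc 0 B with hbox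
  set bad : Finset (ℕ × ℕ) := box.filter fun rs ↦ ¬ Nat.Coprime rs.1 rs.2 with hbad
  have hcard_box : box.card = A * B := by
    rw [hbox, Finset.card_product, Nat.card_Ioc, Nat.card_Ioc]; simp
  have hsplit : (coprimeBox A B).card + bad.card = box.card := by
    rw [coprimeBox, hbad, ← hbox]
    exact Finset.card_filter_add_card_filter_not _
  -- bad ⊆ ⋃_{n ∈ [2, A]} {n ∣ r ∧ n ∣ s}
  have hsub : bad ⊆ (Finset.Icc 2 A).biUnion
      fun n ↦ box.filter (fun rs : ℕ × ℕ ↦ n ∣ rs.1 ∧ n ∣ rs.2) := by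
    intro rs hrs
    rw [hbad, Finset.mem_filter] at hrs
    obtain ⟨hmem, hnc⟩ := hrs
    have hr : 0 < rs.1 ∧ rs.1 ≤ A := by
      have := (Finset.mem_product.mp hmem).1; simpa [Finset.mem_Ioc] using this
    rw [Finset.mem_biUnion]
    refine ⟨Nat.gcd rs.1 rs.2, ?_, ?_⟩
    · rw [Finset.mem_Icc]
      constructor
      · -- gcd ≠ 0 (r > 0) and gcd ≠ 1 (not coprime)
        have h0 : Nat.gcd rs.1 rs.2 ≠ 0 := by
          intro h; exact (Nat.pos_iff_ne_zero.mp hr.1) (Nat.eq_zero_of_gcd_eq_zero_left h)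
        have h1 : Nat.gcd rs.1 rs.2 ≠ 1 := hnc
        omega
      · exact le_trans (Nat.gcd_le_left _ hr.1) hr.2
    · rw [Finset.mem_filter]
      exact ⟨hmem, Nat.gcd_dvd_left _ _, Nat.gcd_dvd_right _ _⟩
  have hbad_le : (bad.card : ℝ) ≤ 3 / 4 * (A * B) := by
    have h1 : bad.card ≤ ∑ n ∈ Finset.Icc 2 A, (A / n) * (B / n) := by
      refine le_trans (Finset.card_le_card hsub) (le_trans Finset.card_biUnion_le ?_)
      refine le_of_eq (Finset.sum_congr rfl fun n _ ↦ ?_)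
      rw [hbox]; exact card_box_filter_dvd A B n
    have h2 : ((∑ n ∈ Finset.Icc 2 A, (A / n) * (B / n) : ℕ) : ℝ)
        ≤ ∑ n ∈ Finset.Icc 2 A, (A : ℝ) * B * (1 / (n : ℝ) ^ 2) := by
      push_cast
      refine Finset.sum_le_sum fun n hn ↦ ?_
      have hn2 : (2 : ℕ) ≤ n := (Finset.mem_Icc.mp hn).1
      have hnpos : (0 : ℝ) < n := by exact_mod_cast (show 0 < n by omega)
      have ha : ((A / n : ℕ) : ℝ) ≤ (A : ℝ) / n := Nat.cast_div_le
      have hb : ((B / n : ℕ) : ℝ) ≤ (B : ℝ) / n := Nat.cast_div_le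
      calc ((A / n : ℕ) : ℝ) * ((B / n : ℕ) : ℝ) ≤ ((A : ℝ) / n) * ((B : ℝ) / n) :=
            mul_le_mul ha hb (Nat.cast_nonneg _) (by positivity)
        _ = (A : ℝ) * B * (1 / (n : ℝ) ^ 2) := by field_simp
    have h3 : ∑ n ∈ Finset.Icc 2 A, (A : ℝ) * B * (1 / (n : ℝ) ^ 2) ≤ (A : ℝ) * B * (3 / 4) := by
      rw [← Finset.mul_sum]
      exact mul_le_mul_of_nonneg_left (sum_Icc_inv_sq_le' A) (by positivity)
    have h1' : (bad.card : ℝ) ≤ ((∑ n ∈ Finset.Icc 2 A, (A / n) * (B / n) : ℕ) : ℝ) := by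
      exact_mod_cast h1
    linarith
  have hsplit' : ((coprimeBox A B).card : ℝ) + bad.card = (A : ℝ) * B := by
    have := congrArg (fun m : ℕ ↦ (m : ℝ)) hsplit
    push_cast at this
    rw [hcard_box] at this
    push_cast at this
    linarith
  linarith

/-! ### Lower bound `X⁵/4 ≤ #𝒞(X)` and the growth constant -/

/-- A coprime pair of positive integers `(r, s)` with `r ≤ X²`, `s ≤ X³` gives a member `E_{r,s}` of
Duke's family `𝒞(X)`: `4r³ + 27s² > 0`, no prime `q` has `q⁴ ∣ r` and `q⁶ ∣ s` (it would divide
`gcd(r, s) = 1`), and `H = max(r³, s²) ≤ X⁶`. [folklore] -/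
theorem natPair_mem_dukeFamily {X : ℕ} {rs : ℕ × ℕ} (h : rs ∈ coprimeBox (X ^ 2) (X ^ 3)) :
    ((rs.1 : ℤ), (rs.2 : ℤ)) ∈ dukeFamily X := by
  rw [coprimeBox, Finset.mem_filter, Finset.mem_product, Finset.mem_Ioc, Finset.mem_Ioc] at h
  obtain ⟨⟨⟨hr0, hrA⟩, ⟨hs0, hsB⟩⟩, hcop⟩ := h
  rw [mem_dukeFamily_iff]
  refine ⟨⟨?_, ?_⟩, ?_⟩
  · have h1 : (0 : ℤ) ≤ 4 * (rs.1 : ℤ) ^ 3 := by positivity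
    have h2 : (0 : ℤ) < (rs.2 : ℤ) := by exact_mod_cast hs0
    have h3 : (0 : ℤ) < 27 * (rs.2 : ℤ) ^ 2 := by positivity
    exact (lt_of_lt_of_le h3 (by linarith)).ne'
  · rintro q hq ⟨h4, h6⟩
    have hq4 : (q : ℤ) ∣ (rs.1 : ℤ) := (dvd_pow_self (q : ℤ) (by norm_num)).trans h4
    have hq6 : (q : ℤ) ∣ (rs.2 : ℤ) := (dvd_pow_self (q : ℤ) (by norm_num)).trans h6
    have hqr : q ∣ rs.1 := by exact_mod_cast hq4
    have hqs : q ∣ rs.2 := by exact_mod_cast hq6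
    have h1 : q ∣ 1 := by
      have := Nat.dvd_gcd hqr hqs
      rwa [hcop.gcd_eq_one] at this
    exact hq.ne_one (Nat.eq_one_of_dvd_one h1)
  · rw [dukeHeight_le_iff]
    constructor
    · rw [Nat.abs_cast]; exact_mod_cast hrA
    · rw [Nat.abs_cast]; exact_mod_cast hsB

/-- The coprime box injects into `𝒞(X)`. [folklore] -/
theorem card_coprimeBox_le_card_dukeFamily (X : ℕ) :
    (coprimeBox (X ^ 2) (X ^ 3)).card ≤ (dukeFamily X).card := by
  refine Finset.card_le_card_of_injOn (fun rs : ℕ × ℕ ↦ ((rs.1 : ℤ), (rs.2 : ℤ)))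
    (fun rs h ↦ natPair_mem_dukeFamily (Finset.mem_coe.mp h)) ?_
  intro a _ b _ hab
  simp only [Prod.mk.injEq, Nat.cast_inj] at hab
  exact Prod.ext hab.1 hab.2

/-- Lower bound: `X⁵/4 ≤ #𝒞(X)`. [folklore] -/
theorem card_dukeFamily_ge (X : ℕ) : (X : ℝ) ^ 5 / 4 ≤ (dukeFamily X).card := by
  have h1 := card_coprimeBox_ge (X ^ 2) (X ^ 3)
  have h2 : ((coprimeBox (X ^ 2) (X ^ 3)).card : ℝ) ≤ (dukeFamily X).card := by
    exact_mod_cast card_coprimeBox_le_card_dukeFamily X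
  push_cast at h1
  have e : (X : ℝ) ^ 2 * (X : ℝ) ^ 3 = (X : ℝ) ^ 5 := by ring
  rw [e] at h1
  linarith

/-- In particular `𝒞(X)` is nonempty for `X ≥ 1`. [folklore] -/
theorem card_dukeFamily_pos {X : ℕ} (hX : 1 ≤ X) : 0 < (dukeFamily X).card := by
  have h := card_dukeFamily_ge X
  have hX' : (1 : ℝ) ≤ X := by exact_mod_cast hX
  have h5 : (0 : ℝ) < (X : ℝ) ^ 5 / 4 := by positivity
  exact_mod_cast (show (0 : ℝ) < (dukeFamily X).card by linarith)

/-- Growth control: `#𝒞(2X + 2) ≤ 17028 · #𝒞(X)` for `X ≥ 1` (`17028 = 4 · 4257`, `4257` = the sum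
of the coefficients of `(2(2X+2)² + 1)(2(2X+2)³ + 1)`). [folklore] -/
theorem card_dukeFamily_growth {X : ℕ} (hX : 1 ≤ X) :
    ((dukeFamily (2 * X + 2)).card : ℝ) ≤ 17028 * (dukeFamily X).card := by
  have hup : ((dukeFamily (2 * X + 2)).card : ℝ)
      ≤ (2 * (2 * (X : ℝ) + 2) ^ 2 + 1) * (2 * (2 * (X : ℝ) + 2) ^ 3 + 1) := by
    exact_mod_cast card_dukeFamily_le (2 * X + 2)
  have hlo := card_dukeFamily_ge X
  have hX' : (1 : ℝ) ≤ X := by exact_mod_cast hX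
  have p1 : (1 : ℝ) ≤ (X : ℝ) ^ 5 := one_le_pow₀ hX'
  have p2 : (X : ℝ) ≤ (X : ℝ) ^ 5 := le_self_pow₀ hX' (by norm_num)
  have p3 : (X : ℝ) ^ 2 ≤ (X : ℝ) ^ 5 := pow_le_pow_right₀ hX' (by norm_num)
  have p4 : (X : ℝ) ^ 3 ≤ (X : ℝ) ^ 5 := pow_le_pow_right₀ hX' (by norm_num)
  have p5 : (X : ℝ) ^ 4 ≤ (X : ℝ) ^ 5 := pow_le_pow_right₀ hX' (by norm_num)
  have e : (2 * (2 * (X : ℝ) + 2) ^ 2 + 1) * (2 * (2 * (X : ℝ) + 2) ^ 3 + 1)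
      = 128 * (X : ℝ) ^ 5 + 640 * (X : ℝ) ^ 4 + 1296 * (X : ℝ) ^ 3 + 1336 * (X : ℝ) ^ 2
        + 704 * (X : ℝ) + 153 := by ring
  rw [e] at hup
  linarith

/-! ### Proportions as cardinalities -/

/-- A proportion below height `X` is `#{filter} / #{family}` (local form of the tree's
`heightProportion_eq_card_div`). [folklore] -/
private theorem heightProportion_eq_card_filter_div' (P : ℤ × ℤ → Prop) (X : ℕ) :
    heightProportion P X
      = (((heightFamilyBelow X).filter P).card : ℝ) / (heightFamilyBelow X).card := by
  unfold heightProportion heightAverage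
  rw [Finset.sum_boole]

/-- Complementary proportions add to `1` once the family below height `X` is nonempty
(`X ≥ 28`). [folklore] -/
private theorem heightProportion_not_add' (P : ℤ × ℤ → Prop) {X : ℕ} (hX : 28 ≤ X) :
    heightProportion (fun AB ↦ ¬ P AB) X + heightProportion P X = 1 := by
  have hpos : (0 : ℝ) < (heightFamilyBelow X).card := by
    exact_mod_cast Finset.card_pos.mpr ⟨_, zeroOne_mem_heightFamilyBelow hX⟩
  unfold heightProportion heightAverage
  rw [← add_div, ← Finset.sum_add_distrib, div_eq_one_iff_eq hpos.ne', Finset.card_eq_sum_ones,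
    Nat.cast_sum]
  refine Finset.sum_congr rfl fun AB _ ↦ ?_
  by_cases hP : P AB <;> simp [hP]

/-! ### The transfer -/

/-- **Duke 1997 in the tree's normalisation.** If `|ℰ(X)|/|𝒞(X)| → 0` (Duke's Theorem 1, the named
fact `Duke1997_exceptionalPrimes_densityZero`), then the curves `E_{A,B}` with NO exceptional prime —
`ρ̄_{E,N}` surjective for every prime `N` — have (lower) naive-height density one in the
Bhargava–Shankar ordering `max(4|A|³, 27B²) < Y` of the tree: the binder `hDuke` of
`PERCENT-FULL.md` §5, up to passing from `E_{A,B}` to an isomorphic minimal model. [folklore] -/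
theorem heightDensityGE_noExceptionalPrime_of_duke (hD : Duke1997_exceptionalPrimes_densityZero) :
    HeightDensityGE (fun AB ↦ ∀ N : ℕ, ¬ IsExceptionalPrime (shortWeierstrass AB) N) 1 := by
  intro ε hε
  -- Duke: eventually (in X) the ratio is below ε / 17028
  have hev : ∀ᶠ X : ℕ in atTop,
      ((dukeExceptionalFamily X).card : ℝ) / (dukeFamily X).card < ε / 17028 :=
    hD.eventually (gt_mem_nhds (by positivity))
  obtain ⟨X₂, hX₂⟩ := eventually_atTop.mp hev
  set M : ℕ := max X₂ 2 with hM
  have hM2 : 2 ≤ M := le_max_right _ _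
  have hMX₂ : X₂ ≤ M := le_max_left _ _
  rw [eventually_atTop]
  refine ⟨max 28 (M ^ 6 + 1), fun Y hY ↦ ?_⟩
  have hY28 : 28 ≤ Y := le_trans (le_max_left _ _) hY
  have hYM : M ^ 6 < Y := lt_of_lt_of_le (Nat.lt_succ_self _) (le_trans (le_max_right _ _) hY)
  -- X₁ := the least X with Y ≤ X⁶
  have hex : ∃ X : ℕ, Y ≤ X ^ 6 := ⟨Y, Nat.le_self_pow (by norm_num) Y⟩
  obtain ⟨X₁, hX₁spec, hX₁min⟩ : ∃ X₁ : ℕ, Y ≤ X₁ ^ 6 ∧ ∀ X < X₁, ¬ Y ≤ X ^ 6 :=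
    ⟨Nat.find hex, Nat.find_spec hex, fun X hX ↦ Nat.find_min hex hX⟩
  have hX₁M : M < X₁ := by
    by_contra h
    have h' : X₁ ≤ M := not_lt.mp h
    have : X₁ ^ 6 ≤ M ^ 6 := Nat.pow_le_pow_left h' 6
    omega
  have hX₁3 : 3 ≤ X₁ := by omega
  have hX₁min' : (X₁ - 1) ^ 6 < Y := by
    have := hX₁min (X₁ - 1) (by omega)
    omega
  -- X₀ := ⌊(X₁ − 1)/2⌋
  set X₀ : ℕ := (X₁ - 1) / 2 with hX₀
  have hX₀1 : 1 ≤ X₀ := by omega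
  have hX₁le : X₁ ≤ 2 * X₀ + 2 := by omega
  have h27 : 27 * X₀ ^ 6 < Y := by
    have h2 : 2 * X₀ ≤ X₁ - 1 := by omega
    have h3 : (2 * X₀) ^ 6 ≤ (X₁ - 1) ^ 6 := Nat.pow_le_pow_left h2 6
    have h4 : (2 * X₀) ^ 6 = 64 * X₀ ^ 6 := by ring
    omega
  -- box nesting
  have hsub₀ : dukeFamily X₀ ⊆ heightFamilyBelow Y := dukeFamily_subset_heightFamilyBelow h27
  have hsub₁ : heightFamilyBelow Y ⊆ dukeFamily X₁ := heightFamilyBelow_subset_dukeFamily hX₁spec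
  -- the exceptional curves below height Y
  set Q : ℤ × ℤ → Prop := fun AB ↦ ∃ N : ℕ, IsExceptionalPrime (shortWeierstrass AB) N with hQ
  have hnum : (((heightFamilyBelow Y).filter Q).card : ℝ) ≤ (dukeExceptionalFamily X₁).card := by
    exact_mod_cast Finset.card_le_card fun AB h ↦ by
      rw [Finset.mem_filter] at h
      rw [mem_dukeExceptionalFamily_iff]
      exact ⟨hsub₁ h.1, h.2⟩
  have hden₀ : ((dukeFamily X₀).card : ℝ) ≤ (heightFamilyBelow Y).card := by
    exact_mod_cast Finset.card_le_card hsub₀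
  have hden₁ : ((dukeFamily X₁).card : ℝ) ≤ (dukeFamily (2 * X₀ + 2)).card := by
    exact_mod_cast Finset.card_le_card (dukeFamily_mono hX₁le)
  have hgrowth := card_dukeFamily_growth hX₀1
  have hD₁pos : (0 : ℝ) < (dukeFamily X₁).card := by exact_mod_cast card_dukeFamily_pos (by omega)
  have hFpos : (0 : ℝ) < (heightFamilyBelow Y).card := by
    exact_mod_cast Finset.card_pos.mpr ⟨_, zeroOne_mem_heightFamilyBelow hY28⟩
  have hratio : ((dukeExceptionalFamily X₁).card : ℝ) / (dukeFamily X₁).card < ε / 17028 :=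
    hX₂ X₁ (by omega)
  have hEnonneg : (0 : ℝ) ≤ (dukeExceptionalFamily X₁).card := Nat.cast_nonneg _
  -- prop(Q, Y) ≤ 17028 · |ℰ(X₁)|/|𝒞(X₁)| < ε
  have hden : ((dukeFamily X₁).card : ℝ) ≤ 17028 * (heightFamilyBelow Y).card := by linarith
  have hpropQ : heightProportion Q Y < ε := by
    rw [heightProportion_eq_card_filter_div']
    have step1 : (((heightFamilyBelow Y).filter Q).card : ℝ) / (heightFamilyBelow Y).card
        ≤ (dukeExceptionalFamily X₁).card / (heightFamilyBelow Y).card :=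
      div_le_div_of_nonneg_right hnum hFpos.le
    have step2 : ((dukeExceptionalFamily X₁).card : ℝ) / (heightFamilyBelow Y).card
        ≤ (dukeExceptionalFamily X₁).card / ((dukeFamily X₁).card / 17028) := by
      refine div_le_div_of_nonneg_left hEnonneg (by positivity) ?_
      linarith
    have step3 : ((dukeExceptionalFamily X₁).card : ℝ) / ((dukeFamily X₁).card / 17028)
        = 17028 * (((dukeExceptionalFamily X₁).card : ℝ) / (dukeFamily X₁).card) := by
      field_simp
    have step4 : 17028 * (((dukeExceptionalFamily X₁).card : ℝ) / (dukeFamily X₁).card) < ε := by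
      have := mul_lt_mul_of_pos_left hratio (by norm_num : (0 : ℝ) < 17028)
      linarith [show (17028 : ℝ) * (ε / 17028) = ε by field_simp]
    linarith [step1, step2, step3.le, step3.ge]
  -- complement
  have e : (fun AB : ℤ × ℤ ↦ ∀ N : ℕ, ¬ IsExceptionalPrime (shortWeierstrass AB) N)
      = fun AB ↦ ¬ Q AB := by
    funext AB
    simp only [hQ, not_exists]
  rw [e]
  have hcomp := heightProportion_not_add' Q hY28
  linarith

end Literature.NumberTheory.EllipticCurves
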